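import Mathlib
import HarnessLib
import Summits.HubbardSuperconductivity.HubbardSuperconductivity.Theses.ComplexGFFStiffness
import Summits.HubbardSuperconductivity.HubbardSuperconductivity.Theorems.ComplexGFFStiffnessF4lPrimeShrink
import Literature.MathematicalPhysics.StatisticalMechanics.AbkmPackageShrunkSlots

/-!
# Route `ComplexGFFStiffness`, child `F4StatementOfCores` of the crux `HypACumulant` — CLOSED (shrunk-ball form)

The route child `F4StatementOfCores` (item `stmt-HubbardSuperconductivity-27415`, re-typed 2026-08-31 by the
crux-strategist) is by definition `GradientRG.TwoKernelSkBound 4 → GradientRG.F4lPrimeShrink 4`: GIVEN the `N`-free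
two-kernel `S_k` bound (12.53) on the Theorem-6.8 ball (the sibling child `TwoKernelSkBound`, open), every `d = 4`
[ABKM19] package admits an `N`-FREE size of the mixed `q`/state slot `F4l'` for the shrunk package `P.shrink`.  It is
the `d = 4` instance of `Theorems.ComplexGFF.f4l'_shrink_of_twoKernelSkBound` (holomorphic route: the `q`-difference
`S_{q'} − S_q` is holomorphic along complex state lines and uniformly bounded by (12.53) on the `P.r`-ball; Cauchy's
estimate with room `7r/8` for states in the `r/8`-ball).

Honest scope: this closes ONE re-typed child (an implication between slots) of ONE crux of a rung route (stiffness
of a complex Gaussian gradient field via the [ABKM19] renormalisation group); its hypothesis `TwoKernelSkBound 4` is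
the open sibling child; nothing about superconductivity in the Hubbard model is proved.

## References
* S. Adams, S. Buchholz, R. Kotecký, S. Müller, arXiv:1910.13564, Lemma 12.6 (12.53), Theorem 6.8, Ch. 12 (12.4)
  [AdamsBuchholzKoteckyMuller2019].
-/

-- `Summit.<Summit>.<Problem>`: single-conjunct summit, the duplicate component is mandated (D-0017).
set_option linter.dupNamespace false

namespace Summit.HubbardSuperconductivity.HubbardSuperconductivity.Theorems

/-- **The route child `F4StatementOfCores` holds**: the `d = 4` instance of
`ComplexGFF.f4l'_shrink_of_twoKernelSkBound` (`TwoKernelSkBound 4 → F4lPrimeShrink 4`).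
[cite: AdamsBuchholzKoteckyMuller2019, Lemma 12.6 (12.53) / Thm 6.8] -/
theorem F4StatementOfCores_proof :
    Summit.HubbardSuperconductivity.HubbardSuperconductivity.Theses.ComplexGFFStiffness.F4StatementOfCores := by
  unfold Summit.HubbardSuperconductivity.HubbardSuperconductivity.Theses.ComplexGFFStiffness.F4StatementOfCores
    Literature.MathematicalPhysics.StatisticalMechanics.GradientRG.F4lPrimeShrink
  intro hTK P _ _
  exact ComplexGFF.f4l'_shrink_of_twoKernelSkBound hTK P

end Summit.HubbardSuperconductivity.HubbardSuperconductivity.Theorems
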